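import Summits.CriticalPhenomena.PercolationContinuityZ3.Theorems.Transplant.AutCylinderOfQuasiNode
import HarnessLib

/-!
# EVERY PERIODIC GRAPH IN EVERY DIMENSION `d ≥ 2` from the quasi-step node: a free action of `ℤ^d` with finitely many orbits on a connected locally finite
# graph gives polynomial growth of degree `d` (kernel), `p_c < 1`, and — through the free-nilpotent growth-degree induction (part IV) — `θ_x(p_c) = 0` at every
# vertex, conditional on the node ALONE

builds on p205010 (kernel theorem, internal audit signed; external expert review pending) — nothing in this file uses p205010; NOTHING is claimed about any
node: the node statement enters only as the hypothesis binder `hNode` (name and words are the lead's).  Lane `prim-bschramm`, seat `prim-bschramm-p5` gen 28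
(refuter / sharpness seat; P5-SHARPNESS §60 row 101: the reach over 2D AND 3D nets — and all higher-dimensional periodic graphs).  Helper file
(`--supports stmt-CriticalPhenomena-4575 --as helper`); PROOFS ONLY (def-free).
* §1 **`ballVolume_le_of_zd_action`**: an action of `ℤ^d` (written `Multiplicative (Site d)`) by automorphisms with finitely many orbits forces
  `|B(x,n)| ≤ |reps|·(2R₀+1)^d·(n+1)^d` — every vertex of a walk of length `n` from `b₀ • r₀` is `(b₀ + a) • r` with `‖a‖_∞ ≤ R₀ n` (`R₀` = the largest coordinate
  of a section of a neighbour of a representative);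
* §2 **`conj4_of_quasiNode_zdPeriodic (hNode) (hd : 2 ≤ d)`**: a connected locally finite graph with a FREE `ℤ^d`-action by automorphisms with finitely many orbits,
  `d ≥ 2`, has `p_c < 1` (projection character to two coordinates, `AutChart.criticalProb_lt_one_of_finite_orbits`) and `θ_x(p_c) = 0` at every vertex
  (`AutCyl.conj4_of_free_nilpotent_of_endStateCyl` — `ℤ^d` is nilpotent, the action free, growth polynomial by §1 — with `hN := endStateCyl_of_quasiNode hNode`).
  Every 2D net (also by finiteness, «AutChartTreeFiniteKernel»), every 3D net (nbo, lon, sod, qtz, dia, slabs, stackings), every `ℤ^d`-periodic graph for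
  `d ≥ 4` (cylinders handled by the induction, no strict-inequality leg).  Not in print beyond `ℤ^d` nearest-neighbour and planar symmetric 2D cases.
[cite: BenjaminiSchramm1996, Conj. 4; §2 (almost transitive graphs)] [cite: Kesten1982, Ch. 3 (periodic graphs)] [cite: KozmaNitzan2024, §4 p. 16]
-/

noncomputable section

namespace Summit.CriticalPhenomena.PercolationContinuityZ3.Theorems.Transplant

open SimpleGraph Literature.Barriers.CriticalPhenomena Literature.Probability.LatticeModels Literature.Probability.Percolation
open scoped Classical

namespace AutChart

/-! ## §1 Polynomial growth of degree `d` from a cocompact `ℤ^d`-action -/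

section Growth

variable {d : ℕ} {W : Type} {X : SimpleGraph W} [MulAction (Multiplicative (Site d)) W]

/-- **Coordinates along a walk**: if `b • r₀` starts a walk of length `n` (`r₀` a representative) and every section of a neighbour of a representative has
sup-norm `≤ R₀`, then every vertex of the walk is `(b · a) • r` with `r` a representative and `‖a‖_∞ ≤ R₀ n`. [folklore] -/
theorem exists_coords_of_mem_support (hact : IsActionByAut X (Multiplicative (Site d))) {reps : Finset W}
    (hcover : ∀ w : W, ∃ a : Multiplicative (Site d), ∃ r ∈ reps, a • r = w) {R₀ : ℕ}
    (hR₀ : ∀ r ∈ reps, ∀ w : W, X.Adj r w → ∀ i : Fin d, |Multiplicative.toAdd (osec hcover w) i| ≤ R₀) :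
    ∀ {u v : W} (p : X.Walk u v) (b : Multiplicative (Site d)) (r₀ : W), r₀ ∈ reps → b • r₀ = u →
      ∀ z ∈ p.support, ∃ (a : Site d) (r : W), r ∈ reps ∧ (b * Multiplicative.ofAdd a) • r = z ∧ ∀ i : Fin d, |a i| ≤ (R₀ : ℤ) * p.length
  | u, _, Walk.nil, b, r₀, hr₀, hb => by
    intro z hz
    rw [Walk.support_nil, List.mem_singleton] at hz
    subst hz
    exact ⟨0, r₀, hr₀, by rw [ofAdd_zero, mul_one, hb], fun i => by simp⟩
  | u, v, Walk.cons (v := u') h p, b, r₀, hr₀, hb => by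
    intro z hz
    rw [Walk.support_cons, List.mem_cons] at hz
    rcases hz with rfl | hz
    · exact ⟨0, r₀, hr₀, by rw [ofAdd_zero, mul_one, hb], fun i => by simp⟩
    · -- pull the first edge back to the representative `r₀`
      have hadj : X.Adj r₀ (b⁻¹ • u') := by
        have h' := (hact b⁻¹ u u').2 h
        rwa [← hb, inv_smul_smul] at h'
      set w := b⁻¹ • u' with hw
      have hw' : (b * osec hcover w) • otyp hcover w = u' := by
        rw [mul_smul, osec_smul, hw, smul_inv_smul]
      obtain ⟨a', r, hr, hz', ha'⟩ := exists_coords_of_mem_support hact hcover hR₀ p (b * osec hcover w) (otyp hcover w) (otyp_mem hcover w) hw' z hz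
      refine ⟨Multiplicative.toAdd (osec hcover w) + a', r, hr, ?_, fun i => ?_⟩
      · rw [← hz', ofAdd_add, ofAdd_toAdd, mul_assoc]
      · have h1 := hR₀ r₀ hr₀ w hadj i
        have h2 := ha' i
        rw [Walk.length_cons, Pi.add_apply]
        rw [abs_le] at h1 h2 ⊢
        push_cast
        constructor <;> nlinarith

variable [X.LocallyFinite]

/-- **POLYNOMIAL GROWTH OF DEGREE `d` from a cocompact `ℤ^d`-action**: `|B(x, n)| ≤ |reps| (2R₀+1)^d (n+1)^d`. [folklore] -/
theorem ballVolume_le_of_zd_action (hact : IsActionByAut X (Multiplicative (Site d))) (reps : Finset W)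
    (hcover : ∀ w : W, ∃ a : Multiplicative (Site d), ∃ r ∈ reps, a • r = w) :
    ∃ C : ℝ, ∀ (x : W) (n : ℕ), (ballVolume X x n : ℝ) ≤ C * ((n : ℝ) + 1) ^ d := by
  -- the section bound `R₀`
  set R₀ : ℕ := reps.sup fun r => (X.neighborFinset r).sup fun w =>
    (Finset.univ : Finset (Fin d)).sup fun i => (Multiplicative.toAdd (osec hcover w) i).natAbs with hR₀_def
  have hR₀ : ∀ r ∈ reps, ∀ w : W, X.Adj r w → ∀ i : Fin d, |Multiplicative.toAdd (osec hcover w) i| ≤ R₀ := by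
    intro r hr w hw i
    have h3 : (Multiplicative.toAdd (osec hcover w) i).natAbs ≤ R₀ :=
      le_trans (le_trans (Finset.le_sup (f := fun i => (Multiplicative.toAdd (osec hcover w) i).natAbs) (Finset.mem_univ i))
        (Finset.le_sup (f := fun w => (Finset.univ : Finset (Fin d)).sup fun i => (Multiplicative.toAdd (osec hcover w) i).natAbs)
          ((X.mem_neighborFinset r w).2 hw)))
        (Finset.le_sup (f := fun r => (X.neighborFinset r).sup fun w =>
          (Finset.univ : Finset (Fin d)).sup fun i => (Multiplicative.toAdd (osec hcover w) i).natAbs) hr)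
    rw [← Int.natCast_natAbs]
    exact_mod_cast h3
  refine ⟨(reps.card : ℝ) * ((2 * R₀ + 1 : ℕ) : ℝ) ^ d, fun x n => ?_⟩
  -- the ball is covered by the image of `box d (R₀ n) × reps`
  obtain ⟨b, r₀, hr₀, hb⟩ := hcover x
  have hsub : graphBall X x n ⊆ ↑(((box d (R₀ * n)) ×ˢ reps).image fun q : Site d × W => (b * Multiplicative.ofAdd q.1) • q.2) := by
    intro z hz
    obtain ⟨p, hp⟩ := hz
    obtain ⟨a, r, hr, hz', ha⟩ := exists_coords_of_mem_support hact hcover hR₀ p b r₀ hr₀ hb z p.end_mem_support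
    rw [Finset.coe_image]
    refine ⟨(a, r), Finset.mem_coe.2 (Finset.mem_product.2 ⟨?_, hr⟩), hz'⟩
    rw [mem_box]
    intro i
    have h := ha i
    rw [abs_le] at h
    have hmono : (R₀ : ℤ) * p.length ≤ (R₀ : ℤ) * n := by exact_mod_cast Nat.mul_le_mul_left R₀ hp
    push_cast
    constructor <;> linarith [h.1, h.2]
  have h1 : ballVolume X x n ≤ (((box d (R₀ * n)) ×ˢ reps).image fun q : Site d × W => (b * Multiplicative.ofAdd q.1) • q.2).card := by
    have h := Set.ncard_le_ncard hsub (Finset.finite_toSet _)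
    rwa [Set.ncard_coe_finset] at h
  have h2 : (((box d (R₀ * n)) ×ˢ reps).image fun q : Site d × W => (b * Multiplicative.ofAdd q.1) • q.2).card ≤ (2 * (R₀ * n) + 1) ^ d * reps.card := by
    refine Finset.card_image_le.trans ?_
    rw [Finset.card_product]
    refine Nat.mul_le_mul_right _ (le_of_eq ?_)
    show (Fintype.piFinset fun _ : Fin d => Finset.Icc (-((R₀ * n : ℕ) : ℤ)) ((R₀ * n : ℕ) : ℤ)).card = _
    rw [Fintype.card_piFinset, Finset.prod_const, Finset.card_univ, Fintype.card_fin, Int.card_Icc]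
    congr 1
    omega
  have h3 : (2 * (R₀ * n) + 1) ^ d ≤ (2 * R₀ + 1) ^ d * (n + 1) ^ d := by
    rw [← mul_pow]
    exact Nat.pow_le_pow_left (by nlinarith) d
  have h4 : ballVolume X x n ≤ reps.card * ((2 * R₀ + 1) ^ d * (n + 1) ^ d) := by
    calc ballVolume X x n ≤ (2 * (R₀ * n) + 1) ^ d * reps.card := h1.trans h2
      _ ≤ (2 * R₀ + 1) ^ d * (n + 1) ^ d * reps.card := Nat.mul_le_mul_right _ h3
      _ = reps.card * ((2 * R₀ + 1) ^ d * (n + 1) ^ d) := by ring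
  have h5 : (ballVolume X x n : ℝ) ≤ (reps.card : ℝ) * (((2 * R₀ + 1 : ℕ) : ℝ) ^ d * (((n : ℝ) + 1) ^ d)) := by exact_mod_cast h4
  linarith [h5]

end Growth

/-! ## §2 Every `ℤ^d`-periodic graph, `d ≥ 2` -/

/-- The projection character `ℤ^d → ℤ²` onto the first two coordinates (`d ≥ 2`). [folklore] -/
theorem exists_projection_character {d : ℕ} (hd : 2 ≤ d) :
    ∃ c : Multiplicative (Site d) →* Multiplicative (Site 2),
      (∀ a : Multiplicative (Site d), ∀ j : Fin 2, Multiplicative.toAdd (c a) j = Multiplicative.toAdd a (Fin.castLE hd j)) := by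
  refine ⟨AddMonoidHom.toMultiplicative
    { toFun := fun v : Site d => fun j : Fin 2 => v (Fin.castLE hd j)
      map_zero' := rfl
      map_add' := fun _ _ => rfl }, fun a j => rfl⟩

/-- **EVERY PERIODIC GRAPH IN DIMENSION `d ≥ 2`, FROM THE QUASI-STEP NODE ALONE**: a connected locally finite graph with a FREE action of `ℤ^d` (as
`Multiplicative (Site d)`) by automorphisms with finitely many orbits has `p_c < 1` and `θ_x(p_c) = 0` at every vertex `x` — the node (hypothesis `hNode`) plus
the free-nilpotent growth-degree induction; NO structure theorem, NO strict-inequality leg, every dimension. [cite: BenjaminiSchramm1996, Conj. 4; §2]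
[cite: Kesten1982, Ch. 3 (periodic graphs)] -/
theorem conj4_of_quasiNode_zdPeriodic {d : ℕ} (hd : 2 ≤ d) {W : Type} {X : SimpleGraph W} [MulAction (Multiplicative (Site d)) W] [X.LocallyFinite]
    (hNode : ∀ {W : Type} (G : SimpleGraph W) [G.LocallyFinite] (Φ : PlanarSkeletonFrmQuasi G) (t : W) (D : ℕ),
      t ∈ Φ.types → Φ.HasProxies t D → Φ.CylSubcritical (criticalProbIOf G t) → theta G t (criticalProbIOf G t) = 0)
    (hact : IsActionByAut X (Multiplicative (Site d))) (hfree : ∀ (a : Multiplicative (Site d)) (w : W), a • w = w → a = 1)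
    (hc : X.Connected) (reps : Finset W) (hcover : ∀ w : W, ∃ a : Multiplicative (Site d), ∃ r ∈ reps, a • r = w) (x : W) :
    criticalProb X x < 1 ∧ theta X x (criticalProbIOf X x) = 0 := by
  obtain ⟨c, hc'⟩ := exists_projection_character hd
  have hstab : ∀ h ∈ MulAction.stabilizer (Multiplicative (Site d)) x, c h = 1 := fun h hh => by
    rw [hfree h x (MulAction.mem_stabilizer_iff.1 hh), map_one]
  have hrank : ∃ a b : Multiplicative (Site d), MaxArea.det2 (Multiplicative.toAdd (c a)) (Multiplicative.toAdd (c b)) ≠ 0 := by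
    refine ⟨Multiplicative.ofAdd (Pi.single (Fin.castLE hd 0) 1), Multiplicative.ofAdd (Pi.single (Fin.castLE hd 1) 1), ?_⟩
    have h0 : Multiplicative.toAdd (c (Multiplicative.ofAdd (Pi.single (Fin.castLE hd 0) 1))) = Pi.single 0 1 := by
      funext j
      rw [hc', toAdd_ofAdd]
      fin_cases j
      · simp
      · rw [Pi.single_eq_of_ne (fun h => absurd (Fin.castLE_injective hd h) (by decide)), Pi.single_eq_of_ne (by decide)]
    have h1 : Multiplicative.toAdd (c (Multiplicative.ofAdd (Pi.single (Fin.castLE hd 1) 1))) = Pi.single 1 1 := by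
      funext j
      rw [hc', toAdd_ofAdd]
      fin_cases j
      · rw [Pi.single_eq_of_ne (fun h => absurd (Fin.castLE_injective hd h) (by decide)), Pi.single_eq_of_ne (by decide)]
      · simp
    rw [h0, h1]
    unfold MaxArea.det2
    simp
  have hpc : criticalProb X x < 1 := criticalProb_lt_one_of_finite_orbits hact hc x reps hcover c hstab hrank x
  refine ⟨hpc, ?_⟩
  obtain ⟨C, hC⟩ := ballVolume_le_of_zd_action hact reps hcover
  exact AutCyl.conj4_of_free_nilpotent_of_endStateCyl (endStateCyl_of_quasiNode hNode) d X hc ⟨C, hC⟩ (Multiplicative (Site d)) hact hfree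
    reps hcover x hpc

end AutChart

end Summit.CriticalPhenomena.PercolationContinuityZ3.Theorems.Transplant

end
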